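import Literature.Topology.FourManifolds.CappellShanesonHomologyProofs
import Literature.Topology.FourManifolds.SPC4Wave0Proofs
import Literature.Topology.FourManifolds.GluckTwistFreedmanSmooth
import HarnessLib

/-!
# Cappell–Shaneson spheres are homotopy 4-spheres: the discharge (Cappell–Shaneson 1976, §2)

Discharge file for the named fact
`Literature.Topology.FourManifolds.nonempty_homotopyEquiv_sphere_four_of_isCappellShanesonSphere`
of `CappellShaneson.lean` — *every Cappell–Shaneson sphere `X` (surgery, either framing, on the
section circle of the mapping torus of `A ∈ SL(3, ℤ)`, `det (A - 1) = ±1`, acting linearly on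
`T³`) is homotopy equivalent to `S⁴`* (S. E. Cappell, J. L. Shaneson, *Some new four-manifolds*,
Ann. of Math. 104 (1976), §2; restated in I. Aitchison, J. Rubinstein, Contemp. Math. 35 (1984),
§1, and R. Gompf, Algebr. Geom. Topol. 10 (2010), §2: "`X^ε_φ` is a homotopy 4-sphere if and only
if `det (A - I) = ±1`").

Nothing new is proved about manifolds here: the whole printed argument was vendored and proved
across `CappellShanesonHomotopySphere.lean` (topology of the surgered manifold, universe
reduction, `ℤ³ ⋊_A ℤ / ⟨⟨t⟩⟩ = 1`), `CappellShanesonSimplyConnected.lean` /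
`CappellShanesonProofs.lean` (`π₁ = 1`, discharged), `CappellShanesonHomology.lean` /
`CappellShanesonWang.lean` / `…WangProofs.lean` / `CappellShanesonHomotopySphereProofs.lean`
(Wang sequence and Mayer–Vietoris: the fact from the homology of `T³` with its `SL(3, ℤ)`-action
and the recognition of homotopy 4-spheres, `…_of_torusFacts'''`), and its last two inputs have
since been DISCHARGED in the tree:

* (T1) `singularHomology_threeTorus_linear_holds` (`CappellShanesonHomologyProofs.lean`; Hatcher
  §3.C Ex. 11 via Poincaré duality for `T³`, Thm. 3.30);
* (W) `nonempty_homotopyEquiv_sphere_four_iff_holds` (`SPC4Wave0Proofs.lean`; `spc4.S10`,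
  Freedman–Quinn §10.1: Hurewicz + Whitehead + Poincaré duality, all proved).

This file records the resulting one-line discharges and their corollaries:

* **`nonempty_homotopyEquiv_sphere_four_of_isCappellShanesonSphere_holds`** — the discharge, at
  every universe;
* **`isZero_singularHomologyZ_two_of_isCappellShanesonSphere_holds`** — discharge of the `H₂ = 0`
  leaf of `CappellShanesonHomotopySphere.lean` (consistency glue
  `isZero_singularHomologyZ_two_of_isCappellShanesonSphere_of` + (W));
* `nonempty_homeomorph_sphere_four_of_isCappellShanesonSphere_of_freedmanPoincare`,
  `…_of_freedmanSmoothCor`, `…_of_thetaFour_hCobordism` — the sibling fact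
  `nonempty_homeomorph_sphere_four_of_isCappellShanesonSphere` (Cappell–Shaneson spheres are
  homeomorphic to `S⁴`) now rests on exactly ONE Freedman-type leaf: Freedman's Thm. 1.6
  `nonempty_homeomorph_sphere_four.{0}`, or his Cor. 1.2 for smooth `V`
  `Freedman1982_nonempty_homeomorph_euclideanSpace_four_of_isManifold.{0}`, or `Θ₄ = 0` together
  with the 5-dimensional TOP h-cobordism theorem (Thm. 1.3); its discharge will be the
  corresponding one-liner (D-0026: no split, no new fact);
* (moved) the unconditional corollaries «the Cappell–Shaneson conjecture is a special case of the
  smooth 4-dimensional Poincaré conjecture in Mathlib's form» and its contrapositive (Kim–Yamada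
  2023, §1; Gompf 2010, §1) now live in `CappellShanesonConsequences.lean`, stated for the
  CANONICAL conjecture leaf `Summit.SmoothPoincare4.SmoothPoincare4.CappellShanesonSpheresStandard`:
  `cappellShanesonSpheresStandard_of_smoothPoincareFour`,
  `not_smoothPoincareFour_of_not_cappellShanesonSpheresStandard'` (conjecture/notion split,
  coordinator 2026-08-15).

No definitions, no named facts; everything is a theorem.

## References

* S. E. Cappell, J. L. Shaneson, *Some new four-manifolds*, Ann. of Math. 104 (1976) 61–72, §2
  [CappellShanesonAnnals1976].
* I. R. Aitchison, J. H. Rubinstein, *Fibered knots and involutions on homotopy spheres*, Contemp.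
  Math. 35 (1984) 1–74, §1 [AitchisonRubinstein1984].
* R. E. Gompf, *More Cappell–Shaneson spheres are standard*, Algebr. Geom. Topol. 10 (2010)
  1665–1681, §§1–2 [GompfAGT2010].
* M. H. Freedman, *The topology of four-dimensional manifolds*, J. Differential Geom. 17 (1982)
  357–453, Thm. 1.6 (p. 371), Cor. 1.2, Thm. 1.3 [FreedmanJDG1982].
* M. H. Kim, S. Yamada, *Ideal classes and Cappell–Shaneson homotopy 4-spheres*, Kyungpook Math.
  J. 63 (2023), §1 [KimYamada2023].
-/

noncomputable section

open scoped Manifold ContDiff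

namespace Literature.Topology.FourManifolds

universe u

/-! ### The discharge -/

/-- **Cappell–Shaneson 1976, §2 (discharged): every Cappell–Shaneson sphere is homotopy
equivalent to `S⁴`.** Discharge of the named fact
`nonempty_homotopyEquiv_sphere_four_of_isCappellShanesonSphere` of `CappellShaneson.lean`, at
every universe: the reduction `…_of_torusFacts'''` (`CappellShanesonWangProofs.lean`: mapping
torus, section circle, surgery, `π₁`, Wang and Mayer–Vietoris sequences, all proved) fed with the
discharged homology of `T³` with its `SL(3, ℤ)`-action (`singularHomology_threeTorus_linear_holds`)
and the discharged recognition of homotopy 4-spheres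
(`nonempty_homotopyEquiv_sphere_four_iff_holds`, `spc4.S10`). Printed statement: "`X^ε_φ` is a
homotopy 4-sphere if and only if `det (A - I) = ±1`" (Gompf 2010, §2, for Cappell–Shaneson's
construction, Ann. of Math. 104 (1976), §2). [cite: CappellShanesonAnnals1976, §2] -/
theorem nonempty_homotopyEquiv_sphere_four_of_isCappellShanesonSphere_holds
    (X : Type u) [TopologicalSpace X] [ChartedSpace (EuclideanSpace ℝ (Fin 4)) X] :
    nonempty_homotopyEquiv_sphere_four_of_isCappellShanesonSphere X :=
  nonempty_homotopyEquiv_sphere_four_of_isCappellShanesonSphere_of_torusFacts'''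
    singularHomology_threeTorus_linear_holds nonempty_homotopyEquiv_sphere_four_iff_holds X

/-- **Cappell–Shaneson 1976, §2 (discharged): `H₂(X; ℤ) = 0` for every Cappell–Shaneson sphere
`X`.** Discharge of the leaf `isZero_singularHomologyZ_two_of_isCappellShanesonSphere` of
`CappellShanesonHomotopySphere.lean`, at every universe, through the homotopy-sphere fact just
discharged and `spc4.S10` (`isZero_singularHomologyZ_two_of_isCappellShanesonSphere_of`).
[cite: CappellShanesonAnnals1976, §2] -/
theorem isZero_singularHomologyZ_two_of_isCappellShanesonSphere_holds
    (X : Type u) [TopologicalSpace X] [ChartedSpace (EuclideanSpace ℝ (Fin 4)) X] :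
    isZero_singularHomologyZ_two_of_isCappellShanesonSphere X :=
  isZero_singularHomologyZ_two_of_isCappellShanesonSphere_of
    nonempty_homotopyEquiv_sphere_four_of_isCappellShanesonSphere_holds
    nonempty_homotopyEquiv_sphere_four_iff_holds X

/-! ### The homeomorphism type: one Freedman leaf left -/

/-- **Cappell–Shaneson spheres are homeomorphic to `S⁴`, over Freedman's Thm. 1.6 alone.** The
named fact `nonempty_homeomorph_sphere_four_of_isCappellShanesonSphere` of `CappellShaneson.lean`
(Cappell–Shaneson 1976, §2 + Freedman, J. Differential Geom. 17 (1982), Thm. 1.6: "If `Σ⁴` is a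
topological 4-manifold homotopy equivalent to the 4-sphere `S⁴`, then `Σ⁴` is homeomorphic to
`S⁴`"), at every universe, from the single remaining leaf `nonempty_homeomorph_sphere_four.{0}`
(`spc4.S04`): the glue `nonempty_homeomorph_sphere_four_of_isCappellShanesonSphere_of`
(`CappellShanesonHomotopySphere.lean`) fed with the discharged homotopy-sphere fact. Its
discharge `…_holds` is this theorem applied to `nonempty_homeomorph_sphere_four_holds` once that
lands. [cite: FreedmanJDG1982, Thm 1.6] -/
theorem nonempty_homeomorph_sphere_four_of_isCappellShanesonSphere_of_freedmanPoincare
    (hF : nonempty_homeomorph_sphere_four.{0})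
    (X : Type u) [TopologicalSpace X] [ChartedSpace (EuclideanSpace ℝ (Fin 4)) X] :
    nonempty_homeomorph_sphere_four_of_isCappellShanesonSphere X :=
  nonempty_homeomorph_sphere_four_of_isCappellShanesonSphere_of
    nonempty_homotopyEquiv_sphere_four_of_isCappellShanesonSphere_holds hF X

/-- **Cappell–Shaneson spheres are homeomorphic to `S⁴`, over Freedman's Cor. 1.2 for smooth `V`
alone** (`Freedman1982_nonempty_homeomorph_euclideanSpace_four_of_isManifold.{0}`, J. Differential
Geom. 17 (1982), Cor. 1.2, p. 366, smooth case): the glue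
`nonempty_homeomorph_sphere_four_of_isCappellShanesonSphere_of_freedman1982_smooth`
(`GluckTwistFreedmanSmooth.lean`) fed with the discharged homotopy-sphere fact.
[cite: FreedmanJDG1982, Cor. 1.2] -/
theorem nonempty_homeomorph_sphere_four_of_isCappellShanesonSphere_of_freedmanSmoothCor
    (hF : Freedman1982_nonempty_homeomorph_euclideanSpace_four_of_isManifold.{0})
    (X : Type u) [TopologicalSpace X] [ChartedSpace (EuclideanSpace ℝ (Fin 4)) X] :
    nonempty_homeomorph_sphere_four_of_isCappellShanesonSphere X :=
  nonempty_homeomorph_sphere_four_of_isCappellShanesonSphere_of_freedman1982_smooth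
    nonempty_homotopyEquiv_sphere_four_of_isCappellShanesonSphere_holds hF X

/-- **Cappell–Shaneson spheres are homeomorphic to `S⁴`, over `Θ₄ = 0` and the 5-dimensional
topological h-cobordism theorem** (`isHCobordant_sphere_of_homotopySphere_four`, Kervaire–Milnor /
Wall; `nonempty_homeomorph_of_isHCobordant_four.{0}`, Freedman 1982, Thm. 1.3): the glue
`nonempty_homeomorph_sphere_four_of_isCappellShanesonSphere_of_thetaFour`
(`HomotopyS4SmoothCase.lean`) fed with the discharged homotopy-sphere fact.
[cite: FreedmanJDG1982, Thm 1.3] -/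
theorem nonempty_homeomorph_sphere_four_of_isCappellShanesonSphere_of_thetaFour_hCobordism
    (hΘ : isHCobordant_sphere_of_homotopySphere_four)
    (h13 : nonempty_homeomorph_of_isHCobordant_four.{0})
    (X : Type u) [TopologicalSpace X] [ChartedSpace (EuclideanSpace ℝ (Fin 4)) X] :
    nonempty_homeomorph_sphere_four_of_isCappellShanesonSphere X :=
  nonempty_homeomorph_sphere_four_of_isCappellShanesonSphere_of_thetaFour
    nonempty_homotopyEquiv_sphere_four_of_isCappellShanesonSphere_holds hΘ h13 X

end Literature.Topology.FourManifolds

end
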